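import Mathlib
import Literature.Analysis.UnboundedOperators.ConjugateOperatorRegularity
import Literature.Analysis.UnboundedOperators.UnitaryRepSpectralMeasure
import Literature.Analysis.UnboundedOperators.FourierSpectrumCalculus
import HarnessLib

/-!
# Stub `stub_mourreThresholdLAP` — Mourre LAP infrastructure 2/4: the virial theorem

Item `stmt-AtomisticToContinuum-12594` (crux `MourreDissolution` of route `EmbeddedDrudeMourre`,
sub-problem `FouriersLaw`), line `separable-vertex-faddeev-pair-sector`, stub S6
`stub_mourreThresholdLAP` = the limiting absorption principle of Mourre theory (ABG Thm 7.4.1 in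
its gap-free `𝒞^{1,1}` form, Sahbani 1997, plus the virial theorem ABG Prop. 7.2.10) over the
tree's vocabulary (`OneParameterUnitaryGroup`, `fourierCalculus`, `HasMourreEstimateOn`,
`HamiltonianOfClassC1/C11`, `spectralMeasure`). The theorem itself is NOT in the tree; these files
(`…LAPSpectralDictionary`, `…LAPVirial`, `…LAPCalculus`, `…LAPLocalisation`) are the sorry-free
bottom of the chain (Mourre LAP infrastructure), reusable by every consumer of the abstract
Mourre `⇒` LAP statement (e.g. route `MourreKoopmanCharges` of `HydrodynamicLimit`).

This file (part 2, independent of part 1):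

* §1 the virial theorem in the tree's smooth-cutoff vocabulary (ABG Prop. 7.2.10 with (7.2.7)):
  for a bounded `S ∈ C¹(A; H)` with `Sψ = cψ`, `S*ψ = c̄ψ` one has `⟪ψ, [S, iA]ψ⟫ = 0` (no domain
  condition on `ψ`); functions of `H` act on eigenvectors `U_t ψ = e^{iEt} ψ` by
  `g(H/2π)ψ = g(E/2π)ψ`; hence a strict Mourre estimate with `a > 0` on an open `J` excludes
  eigenvalues `E ∈ J` (`eq_zero_of_hasMourreEstimateOn_of_eigen`) — also the refutation handle of
  stub S5 (`not_eigen_of_hasMourreEstimateOn`);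
* §2 operators of class `C¹(A; H)` preserve `D(A)`, with `iA(Sf) = S(iAf) - [S, iA]f`
  (the lemma behind `D(A) ∋ ψ ↦ φ(H)ψ ∈ D(A)` in the localisation step of the LAP).
-/

noncomputable section

open MeasureTheory Complex Filter Topology Set
open scoped InnerProductSpace ComplexConjugate SchwartzMap FourierTransform ENNReal NNReal

namespace Summit.AtomisticToContinuum.FouriersLaw.Theorems.MourreDissolution

open Literature.Analysis.UnboundedOperators
open Literature.Analysis.UnboundedOperators.UnitaryRep

variable {H : Type*} [NormedAddCommGroup H] [InnerProductSpace ℂ H] [CompleteSpace H]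

/-! ## §1. The virial theorem: a strict Mourre estimate excludes eigenvectors -/

/-- **Virial lemma for a bounded operator of class `C¹(A; H)`**: if `S ψ = c ψ` and `S* ψ = c̄ ψ`
(stated as `⟪ψ, S u⟫ = c ⟪ψ, u⟫` for all `u`), then the expectation of the commutator
`[S, iA] = d/dx e^{-iAx} S e^{iAx}|₀` in `ψ` vanishes: `⟪ψ, [S, iA] ψ⟫ = 0`. Proof:
`[S, iA] ψ = lim_{x → 0} e^{iAx} x⁻¹ (e^{-iAx} S e^{iAx} - S) ψ = lim x⁻¹ (S e^{iAx} ψ - e^{iAx} S ψ)`,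
and `⟪ψ, S e^{iAx} ψ - e^{iAx} S ψ⟫ = c ⟪ψ, e^{iAx} ψ⟫ - c ⟪ψ, e^{iAx} ψ⟫ = 0`; no domain
condition on `ψ` is needed (ABG Prop. 7.2.10 for bounded `S`).
[cite: AmreinBoutetdeMonvelGeorgescu1996, Prop. 7.2.10] -/
theorem inner_commutator_eq_zero_of_eigen (A : OneParameterUnitaryGroup H) {S D : H →L[ℂ] H}
    (h : A.HasCommutator S D) {ψ : H} {c : ℂ} (hS : S ψ = c • ψ)
    (hS' : ∀ u, ⟪ψ, S u⟫_ℂ = c * ⟪ψ, u⟫_ℂ) : ⟪ψ, D ψ⟫_ℂ = 0 := by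
  -- the difference quotient of `x ↦ 𝒲(x)[S] ψ` at `0`
  have h1 : Tendsto (fun x : ℝ => x⁻¹ • (A.conjAut x S ψ - S ψ)) (𝓝[≠] 0) (𝓝 (D ψ)) := by
    have := (h ψ).tendsto_slope_zero
    simpa using this
  -- apply `W(x) → 1` strongly
  have h2 : Tendsto (fun x : ℝ => A.appReal x (x⁻¹ • (A.conjAut x S ψ - S ψ))) (𝓝[≠] 0)
      (𝓝 (D ψ)) := by
    have hx : Tendsto (fun x : ℝ => x) (𝓝[≠] (0:ℝ)) (𝓝 0) :=
      tendsto_nhdsWithin_of_tendsto_nhds tendsto_id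
    have := OneParameterGroup.tendsto_app_apply_of_tendsto A.toStrongContRepresentation hx h1
    simpa using this
  have h3 : Tendsto (fun x : ℝ => ⟪ψ, A.appReal x (x⁻¹ • (A.conjAut x S ψ - S ψ))⟫_ℂ) (𝓝[≠] 0)
      (𝓝 ⟪ψ, D ψ⟫_ℂ) :=
    Filter.Tendsto.inner tendsto_const_nhds h2
  -- but the inner products vanish identically
  have h4 : ∀ x : ℝ, ⟪ψ, A.appReal x (x⁻¹ • (A.conjAut x S ψ - S ψ))⟫_ℂ = 0 := by
    intro x
    rw [ContinuousLinearMap.map_smul_of_tower, map_sub, conjAut_apply, appReal_apply_appReal_neg,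
      ← Complex.coe_smul, inner_smul_right, inner_sub_right, hS', hS,
      ContinuousLinearMap.map_smul, inner_smul_right, sub_self, mul_zero]
  have h5 : Tendsto (fun x : ℝ => ⟪ψ, A.appReal x (x⁻¹ • (A.conjAut x S ψ - S ψ))⟫_ℂ) (𝓝[≠] 0)
      (𝓝 0) := by
    simp only [h4]
    exact tendsto_const_nhds
  exact tendsto_nhds_unique h3 h5

/-- **Fourier inversion along an eigen-phase**: `∫ 𝓕g(a) e^{iEa} da = g(E/2π)` for Schwartz `g`
(the `2π`-dictionary of `fourierCalculus`: `∫ 𝓕g(a) U(a) da = g(H/2π)`). [folklore] -/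
theorem integral_fourier_mul_cexp (g : 𝓢(ℝ, ℂ)) (E : ℝ) :
    ∫ a, (𝓕 g : 𝓢(ℝ, ℂ)) a * cexp (((E * a : ℝ) : ℂ) * I) = g (E / (2 * Real.pi)) := by
  have h1 : ((𝓕⁻ (𝓕 g : 𝓢(ℝ, ℂ)) : 𝓢(ℝ, ℂ)) : ℝ → ℂ) (E / (2 * Real.pi)) =
      g (E / (2 * Real.pi)) := by
    rw [FourierTransform.fourierInv_fourier_eq]
  rw [← h1, SchwartzMap.fourierInv_coe, Real.fourierInv_eq']
  congr 1
  funext a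
  rw [smul_eq_mul, mul_comm]
  congr 2
  have hπ : Real.pi ≠ 0 := Real.pi_ne_zero
  simp only [real_inner_eq_re_inner]
  simp
  field_simp

/-- **Functions of `H` on an eigenvector**: if `U(t) ψ = e^{iEt} ψ` for all `t`, then
`g(H/2π) ψ = g(E/2π) ψ`, i.e. `U[𝓕g] ψ = g(E/2π) ψ`. [folklore] -/
theorem fourierCalculus_apply_of_eigen (U : OneParameterUnitaryGroup H) (g : 𝓢(ℝ, ℂ)) {E : ℝ}
    {ψ : H} (hψ : ∀ t, U.appReal t ψ = cexp (((E * t : ℝ) : ℂ) * I) • ψ) :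
    U.fourierCalculus g ψ = g (E / (2 * Real.pi)) • ψ := by
  rw [fourierCalculus_apply]
  simp_rw [hψ, smul_smul]
  rw [integral_smul_const, integral_fourier_mul_cexp]

/-- **Adjoint action on an eigenvector**: if `U(t) ψ = e^{iEt} ψ` for all `t`, then
`⟪ψ, g(H/2π) u⟫ = g(E/2π) ⟪ψ, u⟫` for every `u` (i.e. `g(H/2π)* ψ = conj (g(E/2π)) ψ`).
[folklore] -/
theorem inner_fourierCalculus_of_eigen (U : OneParameterUnitaryGroup H) (g : 𝓢(ℝ, ℂ)) {E : ℝ}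
    {ψ : H} (hψ : ∀ t, U.appReal t ψ = cexp (((E * t : ℝ) : ℂ) * I) • ψ) (u : H) :
    ⟪ψ, U.fourierCalculus g u⟫_ℂ = g (E / (2 * Real.pi)) * ⟪ψ, u⟫_ℂ := by
  rw [fourierCalculus_apply, inner_integral_smul_appReal U (𝓕 g : 𝓢(ℝ, ℂ)).integrable]
  have h : ∀ a : ℝ, ⟪ψ, U.appReal a u⟫_ℂ = cexp (((E * a : ℝ) : ℂ) * I) * ⟪ψ, u⟫_ℂ := by
    intro a
    rw [inner_appReal_right, hψ, inner_smul_left, ← Complex.exp_conj, map_mul, Complex.conj_ofReal,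
      Complex.conj_I]
    congr 2
    push_cast
    ring
  simp_rw [h, ← mul_assoc]
  rw [integral_mul_const, integral_fourier_mul_cexp]

/-- The value of `energyMul g` at `E/2π` is `E g(E/2π)`. [folklore] -/
theorem energyMul_apply_div (g : 𝓢(ℝ, ℂ)) (E : ℝ) :
    energyMul g (E / (2 * Real.pi)) = (E : ℂ) * g (E / (2 * Real.pi)) := by
  rw [energyMul_apply]
  congr 1
  have hπ : Real.pi ≠ 0 := Real.pi_ne_zero
  push_cast
  field_simp

/-- **Admissible cutoffs equal to one at a point**: for `J` open and `E ∈ J` there is a real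
Schwartz cutoff `g` with `supp g(·/2π) ⊆ J` (an admissible cutoff of `HasMourreEstimateOn`) and
`g(E/2π) = 1` (a `ContDiffBump` around `E/2π`). [folklore] -/
theorem exists_realCutoff_eq_one {J : Set ℝ} (hJ : IsOpen J) {E : ℝ} (hE : E ∈ J) :
    ∃ g : 𝓢(ℝ, ℂ), IsRealCutoffOn J g ∧ g (E / (2 * Real.pi)) = 1 := by
  set c : ℝ := E / (2 * Real.pi) with hc
  have hJ' : IsOpen ((fun ξ : ℝ => 2 * Real.pi * ξ) ⁻¹' J) := hJ.preimage (by fun_prop)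
  have hcJ : c ∈ (fun ξ : ℝ => 2 * Real.pi * ξ) ⁻¹' J := by
    have hπ : Real.pi ≠ 0 := Real.pi_ne_zero
    have : 2 * Real.pi * c = E := by rw [hc]; field_simp
    show 2 * Real.pi * c ∈ J
    rwa [this]
  obtain ⟨ε, hε, hball⟩ := Metric.isOpen_iff.1 hJ' c hcJ
  let b : ContDiffBump c := ⟨ε / 4, ε / 2, by positivity, by linarith⟩
  set f : ℝ → ℂ := fun x => ((b x : ℝ) : ℂ) with hf
  have hfs : HasCompactSupport f := b.hasCompactSupport.comp_left Complex.ofReal_zero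
  have hfd : ContDiff ℝ (⊤ : ℕ∞) f := Complex.ofRealCLM.contDiff.comp b.contDiff
  refine ⟨hfs.toSchwartzMap hfd, ⟨fun ξ => ?_, ?_, ?_⟩, ?_⟩
  · simp [hf]
  · exact hfs
  · calc tsupport ((hfs.toSchwartzMap hfd : 𝓢(ℝ, ℂ)) : ℝ → ℂ) = tsupport f := rfl
      _ ⊆ tsupport (b : ℝ → ℝ) := tsupport_comp_subset Complex.ofReal_zero _
      _ = Metric.closedBall c (ε / 2) := b.tsupport_eq
      _ ⊆ Metric.ball c ε := Metric.closedBall_subset_ball (by linarith)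
      _ ⊆ _ := hball
  · show ((b c : ℝ) : ℂ) = 1
    rw [b.one_of_mem_closedBall (Metric.mem_closedBall_self (by positivity))]
    simp

/-- **The virial theorem (smooth-cutoff form; ABG Prop. 7.2.10 + (7.2.7))**: a strict Mourre
estimate with constant `a > 0` on an open set `J` excludes eigenvectors of the group with
eigenvalue in `J`: if `U(t) ψ = e^{iEt} ψ` for all `t` with `E ∈ J`, then `ψ = 0`. Indeed for an
admissible cutoff `φ = g(·/2π)` with `φ(E) = 1`: `φ(H) ψ = ψ`, `φ₁(H) ψ = E ψ`, and the virial
lemma kills both commutator expectations in `⟪ψ, φ(H)[H, iA]φ(H) ψ⟫ = ⟪ψ, [φ₁(H), iA] ψ⟫ -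
E ⟪ψ, [φ(H), iA] ψ⟫ = 0`, so `a ‖ψ‖² ≤ 0`.
[cite: AmreinBoutetdeMonvelGeorgescu1996, Prop. 7.2.10] -/
theorem eq_zero_of_hasMourreEstimateOn_of_eigen {U A : OneParameterUnitaryGroup H} {J : Set ℝ}
    {a : ℝ} (hM : U.HasMourreEstimateOn A J a) (ha : 0 < a) (hJ : IsOpen J) {E : ℝ} (hE : E ∈ J)
    {ψ : H} (hψ : ∀ t, U.appReal t ψ = cexp (((E * t : ℝ) : ℂ) * I) • ψ) : ψ = 0 := by
  obtain ⟨g, hg, hg1⟩ := exists_realCutoff_eq_one hJ hE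
  obtain ⟨h0, h1, hest⟩ := hM g hg
  -- eigen-relations for `φ(H)` and `φ₁(H) = H φ(H)`
  have e0 : U.fourierCalculus g ψ = ψ := by
    rw [fourierCalculus_apply_of_eigen U g hψ, hg1, one_smul]
  have e0' : ∀ u, ⟪ψ, U.fourierCalculus g u⟫_ℂ = 1 * ⟪ψ, u⟫_ℂ := fun u => by
    rw [inner_fourierCalculus_of_eigen U g hψ, hg1]
  have e1 : U.fourierCalculus (energyMul g) ψ = (E : ℂ) • ψ := by
    rw [fourierCalculus_apply_of_eigen U (energyMul g) hψ, energyMul_apply_div, hg1, mul_one]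
  have e1' : ∀ u, ⟪ψ, U.fourierCalculus (energyMul g) u⟫_ℂ = (E : ℂ) * ⟪ψ, u⟫_ℂ := fun u => by
    rw [inner_fourierCalculus_of_eigen U (energyMul g) hψ, energyMul_apply_div, hg1, mul_one]
  -- virial lemma for both bounded commutators
  have v0 : ⟪ψ, A.commutatorCLM (U.fourierCalculus g) ψ⟫_ℂ = 0 :=
    inner_commutator_eq_zero_of_eigen A h0.hasCommutator (c := 1) (by rw [e0, one_smul]) e0'
  have v1 : ⟪ψ, A.commutatorCLM (U.fourierCalculus (energyMul g)) ψ⟫_ℂ = 0 :=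
    inner_commutator_eq_zero_of_eigen A h1.hasCommutator e1 e1'
  have hM0 : ⟪ψ, U.mourreCommutator A g ψ⟫_ℂ = 0 := by
    rw [mourreCommutator, _root_.sub_apply, mul_apply_eq_comp, mul_apply_eq_comp, inner_sub_right,
      e0', e1', v0, v1]
    ring
  have h := hest ψ
  rw [hM0, Complex.zero_re, e0] at h
  have hn : ‖ψ‖ ^ 2 ≤ 0 := by
    by_contra hlt
    have := mul_pos ha (lt_of_not_ge hlt)
    linarith
  have : ‖ψ‖ = 0 := by nlinarith [norm_nonneg ψ]
  exact norm_eq_zero.1 this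

/-- **No eigenvalues in a Mourre window** (contrapositive packaging): under a strict Mourre estimate
with `a > 0` on an open `J`, a non-zero `ψ` cannot satisfy `U(t) ψ = e^{iEt} ψ` with `E ∈ J`.
[cite: AmreinBoutetdeMonvelGeorgescu1996, Prop. 7.2.10] -/
theorem not_eigen_of_hasMourreEstimateOn {U A : OneParameterUnitaryGroup H} {J : Set ℝ}
    {a : ℝ} (hM : U.HasMourreEstimateOn A J a) (ha : 0 < a) (hJ : IsOpen J) {E : ℝ} (hE : E ∈ J)
    {ψ : H} (hψ : ψ ≠ 0) : ¬ ∀ t, U.appReal t ψ = cexp (((E * t : ℝ) : ℂ) * I) • ψ :=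
  fun h => hψ (eq_zero_of_hasMourreEstimateOn_of_eigen hM ha hJ hE h)


/-- **The virial theorem, headline form** (all binders explicit; registered helper stub of
`stub_mourreThresholdLAP`): a strict Mourre estimate with `a > 0` on an open `J` excludes
eigenvectors `U_t ψ = e^{iEt} ψ` of the group with `E ∈ J`.
[cite: AmreinBoutetdeMonvelGeorgescu1996, Prop. 7.2.10] -/
theorem virial_eq_zero_of_hasMourreEstimateOn :
    ∀ (K : Type) [NormedAddCommGroup K] [InnerProductSpace ℂ K] [CompleteSpace K]
      (U A : Literature.Analysis.UnboundedOperators.OneParameterUnitaryGroup K) (J : Set ℝ) (a : ℝ),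
      U.HasMourreEstimateOn A J a → 0 < a → IsOpen J →
      ∀ (E : ℝ), E ∈ J → ∀ (ψ : K),
        (∀ t : ℝ, U.appReal t ψ = Complex.exp (((E * t : ℝ) : ℂ) * Complex.I) • ψ) → ψ = 0 := by
  intro K _ _ _ U A J a hM ha hJ E hE ψ hψ
  exact eq_zero_of_hasMourreEstimateOn_of_eigen hM ha hJ hE hψ

/-! ## §2. Operators of class `C¹(A; H)` preserve `D(A)` -/

/-- **`C¹(A; H)` operators leave `D(A)` invariant** (ABG Prop. 6.2.10-type statement for bounded
`S`; the lemma behind `D(A) ∋ ψ ↦ φ(H)ψ ∈ D(A)` in the localisation step of the LAP): if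
`x ↦ e^{-iAx} S e^{iAx}` has strong derivative `D = [S, iA]` at `0` and `f ∈ D(A)`, then
`S f ∈ D(A)` and `iA (S f) = S (iA f) - [S, iA] f` (`iA` = the generator of `e^{iAx}`).
Proof: `e^{iAx} S f = (e^{iAx} S e^{-iAx}) (e^{iAx} f)` is differentiable at `0` by the strong
product rule `hasDerivAt_apply_of_strongDeriv`. [folklore] -/
theorem apply_mem_generator_domain_of_hasCommutator (A : OneParameterUnitaryGroup H)
    {S D : H →L[ℂ] H} (h : A.HasCommutator S D) {f : H}
    (hf : f ∈ (OneParameterGroup.generator A.toStrongContRepresentation).domain) :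
    ∃ hSf : S f ∈ (OneParameterGroup.generator A.toStrongContRepresentation).domain,
      OneParameterGroup.generator A.toStrongContRepresentation ⟨S f, hSf⟩ =
        S (OneParameterGroup.generator A.toStrongContRepresentation ⟨f, hf⟩) - D f := by
  set gen := OneParameterGroup.generator A.toStrongContRepresentation with hgen
  -- `F x = 𝒲(-x)[S]`, strong derivative `-D f` at the vector `f`
  have hFu : HasDerivAt (fun x : ℝ => A.conjAut (-x) S f) (-(D f)) 0 := by
    have h1 : HasDerivAt (fun y : ℝ => A.conjAut y S f) (D f) (-0) := by simpa using h f
    have h2 := h1.scomp (0 : ℝ) (hasDerivAt_neg (0 : ℝ))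
    simpa [Function.comp_def] using h2
  have hcont : Tendsto (fun x : ℝ => A.conjAut (-x) S (gen ⟨f, hf⟩)) (𝓝 0)
      (𝓝 (A.conjAut (-0) S (gen ⟨f, hf⟩))) := by
    have hc : Continuous fun y : ℝ => A.conjAut y S (gen ⟨f, hf⟩) :=
      continuous_iff_continuousAt.2 fun y => (h.hasDerivAt_conjAut y _).continuousAt
    exact (hc.comp continuous_neg).tendsto 0
  -- `u x = W(x) f`, derivative `iA f` at `0`
  have hu : HasDerivAt (fun x : ℝ => A.appReal x f) (gen ⟨f, hf⟩) 0 := by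
    simpa using A.hasDerivAt_appReal_apply ⟨f, hf⟩ 0
  have key := hasDerivAt_apply_of_strongDeriv (F := fun x => A.conjAut (-x) S)
    (u := fun x => A.appReal x f) hFu hcont (fun x => A.norm_conjAut_le (-x) S) hu (by simp)
  have hfun : (fun x : ℝ => A.conjAut (-x) S (A.appReal x f)) = fun x => A.appReal x (S f) := by
    funext x
    rw [conjAut_apply, neg_neg, appReal_neg_apply_appReal]
  rw [hfun] at key
  simp only [neg_zero, conjAut_zero] at key
  have key' : HasDerivAt (fun x : ℝ => OneParameterGroup.app A.toStrongContRepresentation x (S f))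
      (S (gen ⟨f, hf⟩) - D f) 0 := by
    have : S (gen ⟨f, hf⟩) - D f = -(D f) + S (gen ⟨f, hf⟩) := by abel
    rw [this]
    simpa using key
  exact OneParameterGroup.mem_generator_domain_of_hasDerivAt A.toStrongContRepresentation key'

/-- **`C¹(A; H)` operators preserve `D(A)`** (domain statement at the level of `A.hamiltonian`,
the form in which `ψ ∈ D(A)` enters the stub). [folklore] -/
theorem IsOfClassC1.apply_mem_hamiltonian_domain {A : OneParameterUnitaryGroup H} {S : H →L[ℂ] H}
    (h : A.IsOfClassC1 S) {f : H} (hf : f ∈ A.hamiltonian.domain) : S f ∈ A.hamiltonian.domain := by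
  rw [hamiltonian_domain] at hf ⊢
  exact (apply_mem_generator_domain_of_hasCommutator A h.hasCommutator hf).1

end Summit.AtomisticToContinuum.FouriersLaw.Theorems.MourreDissolution
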